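import Summits.CriticalPhenomena.SAWScalingLimit.Theses.SAWQuarterTwist

/-!
# Strategist s5a — split certificate (part 1) for crux `SAWQuarterTwist.ObservableToSLER` (stmt-CriticalPhenomena-14005)

Route-file context, NO new imports: the three children of `children-SAWQuarterTwist-s5a.json` elaborate inside the route namespace and
the glue `MacroSourceLocality → HexSimpleSubseqLimits → AnchoredObservableToSLER → ObservableToSLER` is modus ponens.  Children 1, 2 are
byte-identical to items stmt-17955 / stmt-7148; child 3 is new.  Part 2 (`SplitGlue_s5a.lean`): child 3 ⇐ item 17698 + the solid squeeze,
via the landed `Residue.observableToSLER_of_residueMacro` (p148257).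
-/

namespace Summit.CriticalPhenomena.SAWScalingLimit.Theses.SAWQuarterTwist

/-- child 1 = item stmt-CriticalPhenomena-17955 verbatim (MACROSCOPIC SOURCE LOCALITY, the weakened anchor). -/
def MacroSourceLocality : Prop :=
  ∀ (E : Literature.Probability.RandomPlanarGeometry.DobrushinDomain) (ρ : ℝ) (Λ : ℝ → Finset Literature.Probability.LatticeModels.HexVertex) (m₀ : ℝ → ℤ) (a : ℝ → Sym2 Literature.Probability.LatticeModels.HexVertex), 0 < ρ → E.carrier ∩ Metric.ball (E.pt 0) ρ = {z : ℂ | (E.pt 0).im < z.im} ∩ Metric.ball (E.pt 0) ρ → (∀ᶠ δ : ℝ in nhdsWithin 0 (Set.Ioi 0), Literature.Probability.RandomPlanarGeometry.SAW.hexDomainSimplyConnected (Λ δ) ∧ (Literature.Probability.LatticeModels.hexGraph.induce ((Λ δ : Finset Literature.Probability.LatticeModels.HexVertex) : Set Literature.Probability.LatticeModels.HexVertex)).Preconnected ∧ a δ ∈ Literature.Probability.RandomPlanarGeometry.SAW.hexDomainBoundary (Λ δ) ∧ (∀ v ∈ Λ δ, (δ : ℂ) * Literature.Probability.LatticeModels.hexCenter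 v ∈ E.carrier) ∧ (∀ v : Literature.Probability.LatticeModels.HexVertex, (δ : ℂ) * Literature.Probability.LatticeModels.hexCenter v ∈ Metric.ball (E.pt 0) ρ → (v ∈ Λ δ ↔ m₀ δ ≤ v.1 1))) → (∀ K : Set ℂ, IsCompact K → K ⊆ E.carrier → ∀ᶠ δ : ℝ in nhdsWithin 0 (Set.Ioi 0), ∀ v : Literature.Probability.LatticeModels.HexVertex, (δ : ℂ) * Literature.Probability.LatticeModels.hexCenter v ∈ K → v ∈ Λ δ) → Filter.Tendsto (fun δ : ℝ => (δ : ℂ) * Literature.Probability.RandomPlanarGeometry.SAW.hexMidpoint (a δ)) (nhdsWithin 0 (Set.Ioi 0)) (nhds (E.pt 0)) → ∀ ε : ℝ, 0 < ε → ∀ r : ℝ, 0 < r → ∃ t₀ : ℝ, 0 < t₀ ∧ ∀ (s : ℝ → Sym2 Literature.Probability.LatticeModels.HexVertex) (t : ℝ), t ≠ 0 → |t| < t₀ → (∀ᶠ δ : ℝ in nhdsWithin 0 (Set.Ioi 0), s δ ∈ Literature.Probability.RandomPlanarGeometry.SAW.hexDomainBoundary (Λ δ) ∧ (Literature.Probability.RandomPlanarGeometry.SAW.hexMidpoint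 (s δ)).im = (Literature.Probability.RandomPlanarGeometry.SAW.hexMidpoint (a δ)).im) → Filter.Tendsto (fun δ : ℝ => (δ : ℂ) * Literature.Probability.RandomPlanarGeometry.SAW.hexMidpoint (s δ)) (nhdsWithin 0 (Set.Ioi 0)) (nhds (E.pt 0 + t)) → ∀ᶠ δ : ℝ in nhdsWithin 0 (Set.Ioi 0), (∑ γ : Literature.Probability.RandomPlanarGeometry.SAW.HexMidEdgeSAW (Λ δ) (a δ) (s δ), if ∃ v ∈ γ.verts, r ≤ dist ((δ : ℂ) * Literature.Probability.LatticeModels.hexCenter v) ((δ : ℂ) * Literature.Probability.RandomPlanarGeometry.SAW.hexMidpoint (a δ)) then Literature.Probability.RandomPlanarGeometry.SAW.hexCriticalFugacity ^ γ.length else 0) ≤ ε * ∑ γ : Literature.Probability.RandomPlanarGeometry.SAW.HexMidEdgeSAW (Λ δ) (a δ) (s δ), Literature.Probability.RandomPlanarGeometry.SAW.hexCriticalFugacity ^ γ.length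

/-- child 2 = item stmt-CriticalPhenomena-7148 verbatim (SIMPLICITY of subsequential limits). -/
def HexSimpleSubseqLimits : Prop :=
  ∀ (D : Literature.Probability.RandomPlanarGeometry.DobrushinDomain) (a b : ℝ → Literature.Probability.LatticeModels.HexVertex), Literature.Probability.RandomPlanarGeometry.SAW.IsEmbEndpointApprox Literature.Probability.LatticeModels.hexGraph Literature.Probability.LatticeModels.hexCenter D a b → ∀ (s : ℕ → ℝ) (ν : MeasureTheory.Measure (Literature.Probability.RandomPlanarGeometry.CurveClass ℂ)), Filter.Tendsto s Filter.atTop (nhdsWithin 0 (Set.Ioi 0)) → MeasureTheory.IsProbabilityMeasure ν → (∀ f : BoundedContinuousFunction (Literature.Probability.RandomPlanarGeometry.CurveClass ℂ) ℝ, Filter.Tendsto (fun n => ∫ γ, f γ.curve ∂(Literature.Probability.RandomPlanarGeometry.SAW.hexSAWLaw D.carrier (s n) (a (s n)) (b (s n)))) Filter.atTop (nhds (∫ x, f x ∂ν))) → ∀ᵐ γ ∂ν, γ ∈ Literature.Probability.RandomPlanarGeometry.CurveClass.simple ∧ γ.source = D.pt 0 ∧ γ.target = D.pt 1 ∧ γ.range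 ⊆ closure D.carrier ∧ γ.range ∩ frontier D.carrier ⊆ {D.pt 0, D.pt 1}

/-- child 3 (NEW): the ABUNDANCE HALF — given the weakened anchor and simplicity, the crux. -/
def AnchoredObservableToSLER : Prop :=
  MacroSourceLocality → HexSimpleSubseqLimits → HexObservableLimitR → HexTight → ∀ (D : Literature.Probability.RandomPlanarGeometry.DobrushinDomain) (a b : ℝ → Literature.Probability.LatticeModels.HexVertex), Literature.Probability.RandomPlanarGeometry.SAW.IsEmbEndpointApprox Literature.Probability.LatticeModels.hexGraph Literature.Probability.LatticeModels.hexCenter D a b → Literature.Probability.RandomPlanarGeometry.ConvergesInLawToSLE ((8 : NNReal) / 3) D (fun δ (γ : Literature.Probability.RandomPlanarGeometry.SAW.HexDomainSAW D.carrier δ (a δ) (b δ)) => γ.curve) (fun δ => Literature.Probability.RandomPlanarGeometry.SAW.hexSAWLaw D.carrier δ (a δ) (b δ))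

/-- The split glue: modus ponens. -/
theorem ObservableToSLER_of_subs :
    MacroSourceLocality → HexSimpleSubseqLimits → AnchoredObservableToSLER → ObservableToSLER :=
  fun hM hS hA => hA hM hS

/-- child 3 is literally `MacroSourceLocality → HexSimpleSubseqLimits → ObservableToSLER`. -/
theorem anchored_iff : AnchoredObservableToSLER ↔ (MacroSourceLocality → HexSimpleSubseqLimits → ObservableToSLER) :=
  Iff.rfl

end Summit.CriticalPhenomena.SAWScalingLimit.Theses.SAWQuarterTwist
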